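import Mathlib
import Summits.QuantumFields.YangMills.Theses.CoarseStiffnessTail
import Summits.QuantumFields.YangMills.Theorems.SmallFieldWideningLargeFieldMassRefinementTailSubGaussianRung

/-!
# Route `CoarseStiffnessTail`, crux `CappedCoarseStiffnessL` (stmt-QuantumFields-25301), line `birth` — the CHEAP STUB
# `stub_cgfConvexCapped`: CONVEXITY OF THE CUMULANT GENERATING FUNCTION (`Λ(c) ≤ c·Λ′(c)`), proved for every bounded observable

Prover seat `ym-line-cst-p1` (g0).  Support file (`--supports stmt-QuantumFields-25301`) for the registered BC3 birth skeleton of the crux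
`CappedCoarseStiffnessL` (ideator `ym-r3-idea-2` g0; two stubs: `stub_cgfConvexCapped` (M, provable now — THIS FILE) and `stub_tiltedCappedMoment`
(XL, the capped second moment under the tilted law — NOT here, NOT attacked before the instrument row JOB A reports)).  The skeleton's composition is
`CappedCoarseStiffnessL ⇐ [Λ(c₀) ≤ c₀Λ′(c₀)] + [Λ′(c₀) ≤ C₀·#Plaq_j]` with `Λ(c) = log ∫ exp(c·X) dGibbs_K`, `X = capStiff` the capped stiffness
`β_{K−j}·Σ_a min(|Ū^j(∂a) − 1|², θ(K−j)²)`.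

* §1 `integral_exp_le_exp_tilted_mean` — **GIBBS' INEQUALITY IN MOMENT FORM**: for a probability measure `μ` and a bounded measurable `f`,
  `∫ e^f dμ ≤ exp( ∫ f e^f dμ / ∫ e^f dμ )`, i.e. `log Z ≤ E_{μ_f}[f]` for the tilted law `μ_f = e^f μ / Z` — Jensen for `exp` under `μ_f` applied to
  `−f` (`E_{μ_f}[e^{−f}] = 1/Z`); equivalently `KL(μ_f ‖ μ) ≥ 0`, equivalently convexity of `c ↦ log ∫ e^{cf}` with value `0` at `c = 0`.
* §2 `cgfConvex_capStiff` — the instance for the capped stiffness observable of the crux (bounded by `β·#Plaq_j·θ²`; measurable through the landed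
  `LargeFieldMassRefinementTailSubGaussianRung.measurable_dist1_iter`), for EVERY real `c` and every `γ ≥ 0`.
* §3 `stub_cgfConvexCapped` — the REGISTERED STUB by name and signature (lead's reshape r1 of the skeleton states both stubs def-free, the ideator's
  abbreviation `capStiff` written out; guards `0 < γ`, `0 ≤ c` idle).

HONEST SCOPE.  Soft measure theory; nothing of Bałaban.  The crux `CappedCoarseStiffnessL` stays OPEN (its content is the other stub); no rung, leaf or
summit is proved (R3 record rung; `YM3TorusSU2` NOT proved; the Yang–Mills mass gap is NOT touched).
-/

noncomputable section

namespace Summit.QuantumFields.YangMills.Theorems.CoarseStiffnessTailCappedCoarseStiffnessLCgfConvex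

open MeasureTheory
open Literature.MathematicalPhysics.QuantumFieldTheory
open Literature.MathematicalPhysics.QuantumFieldTheory.Balaban1983to89
open Literature.MathematicalPhysics.QuantumFieldTheory.Balaban1983to89.T3ContinuumYM3Torus
open Summit.QuantumFields.YangMills.Theorems.LargeFieldMassRefinementTailSubGaussianRung (measurable_dist1_iter)

/-! ## §1 Gibbs' inequality in moment form -/

section Gibbs

variable {Ω : Type*} [MeasurableSpace Ω]

/-- A bounded measurable real function is integrable for every finite measure (plumbing). [folklore] -/
theorem integrable_of_abs_le (μ : Measure Ω) [IsFiniteMeasure μ] {f : Ω → ℝ} (hf : Measurable f) {B : ℝ}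
    (hB : ∀ x, |f x| ≤ B) : Integrable f μ :=
  (integrable_const B).mono' hf.aestronglyMeasurable (ae_of_all _ fun x => by rw [Real.norm_eq_abs]; exact hB x)

/-- **GIBBS' INEQUALITY IN MOMENT FORM** (`Λ(1) ≤ Λ′(1)` for the convex `Λ(c) = log ∫ e^{cf} dμ`, `Λ(0) = 0`): for a probability measure `μ`
and a bounded measurable `f`, `∫ e^f dμ ≤ exp(∫ f e^f dμ / ∫ e^f dμ)`.  Proof: Jensen for `exp` under the tilted probability law
`μ_f = e^f μ / Z` applied to `−f`: `exp(−E_{μ_f} f) ≤ E_{μ_f} e^{−f} = 1/Z`. [folklore] -/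
theorem integral_exp_le_exp_tilted_mean (μ : Measure Ω) [IsProbabilityMeasure μ] {f : Ω → ℝ} (hf : Measurable f) {B : ℝ}
    (hB : ∀ x, |f x| ≤ B) :
    ∫ x, Real.exp (f x) ∂μ ≤ Real.exp ((∫ x, f x * Real.exp (f x) ∂μ) / (∫ x, Real.exp (f x) ∂μ)) := by
  -- integrability of `e^f` under `μ`
  have hexpB : ∀ x, |Real.exp (f x)| ≤ Real.exp B := fun x => by
    rw [abs_of_pos (Real.exp_pos _)]
    exact Real.exp_le_exp.mpr ((le_abs_self _).trans (hB x))
  have hexp : Integrable (fun x => Real.exp (f x)) μ := integrable_of_abs_le μ (Real.measurable_exp.comp hf) hexpB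
  set Z : ℝ := ∫ x, Real.exp (f x) ∂μ with hZdef
  have hZ : 0 < Z := integral_exp_pos hexp
  -- the tilted probability law
  set ν : Measure Ω := μ.tilted f with hνdef
  haveI : IsProbabilityMeasure ν := isProbabilityMeasure_tilted hexp
  -- Jensen for `exp` under `ν`, applied to `−f`
  have hfν : Integrable (fun x => -f x) ν :=
    integrable_of_abs_le ν hf.neg (B := B) fun x => by rw [abs_neg]; exact hB x
  have hgν : Integrable (Real.exp ∘ fun x => -f x) ν := by
    refine integrable_of_abs_le ν (Real.measurable_exp.comp hf.neg) (B := Real.exp B) fun x => ?_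
    show |Real.exp (-f x)| ≤ Real.exp B
    rw [abs_of_pos (Real.exp_pos _)]
    exact Real.exp_le_exp.mpr ((neg_le_abs _).trans (hB x))
  have hJ := ConvexOn.map_integral_le (μ := ν) convexOn_exp Real.continuous_exp.continuousOn isClosed_univ
    (ae_of_all _ fun x => Set.mem_univ (-f x)) hfν hgν
  -- both sides of Jensen in closed form
  have h1 : ∫ x, Real.exp (-f x) ∂ν = Z⁻¹ := by
    have hint : (fun x => (Real.exp (f x) / ∫ x, Real.exp (f x) ∂μ) • Real.exp (-f x)) = fun _ => Z⁻¹ := by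
      funext x
      simp only [smul_eq_mul, ← hZdef]
      rw [div_mul_eq_mul_div, ← Real.exp_add, add_neg_cancel, Real.exp_zero, one_div]
    rw [hνdef, integral_tilted, hint, integral_const, smul_eq_mul, probReal_univ, one_mul]
  have h2 : ∫ x, -f x ∂ν = -((∫ x, f x * Real.exp (f x) ∂μ) / Z) := by
    have hint : (fun x => (Real.exp (f x) / ∫ x, Real.exp (f x) ∂μ) • (-f x)) = fun x => -(f x * Real.exp (f x) / Z) := by
      funext x
      simp only [smul_eq_mul, ← hZdef]
      ring
    rw [hνdef, integral_tilted, hint, integral_neg, integral_div]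
  rw [h1, h2] at hJ
  -- `exp(−m) ≤ Z⁻¹` ⇒ `Z ≤ exp m`
  have h3 : Z ≤ (Real.exp (-((∫ x, f x * Real.exp (f x) ∂μ) / Z)))⁻¹ := (le_inv_comm₀ (Real.exp_pos _) hZ).mp hJ
  rwa [Real.exp_neg, inv_inv] at h3

/-- The same with a tilt parameter pulled out: `∫ e^{cX} dμ ≤ exp(c · ∫ X e^{cX} dμ / ∫ e^{cX} dμ)` for bounded measurable `X` and every real `c`
(`Λ(c) ≤ cΛ′(c)`). [folklore] -/
theorem integral_exp_mul_le_exp_mul_tilted_mean (μ : Measure Ω) [IsProbabilityMeasure μ] {X : Ω → ℝ} (hX : Measurable X) {B : ℝ}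
    (hB : ∀ x, |X x| ≤ B) (c : ℝ) :
    ∫ x, Real.exp (c * X x) ∂μ ≤ Real.exp (c * ((∫ x, X x * Real.exp (c * X x) ∂μ) / (∫ x, Real.exp (c * X x) ∂μ))) := by
  have h := integral_exp_le_exp_tilted_mean μ (hX.const_mul c) (B := |c| * B) fun x => by
    rw [abs_mul]; exact mul_le_mul_of_nonneg_left (hB x) (abs_nonneg c)
  refine h.trans (le_of_eq ?_)
  congr 1
  have : (fun x => c * X x * Real.exp (c * X x)) = fun x => c * (X x * Real.exp (c * X x)) := by
    funext x; ring
  rw [this, integral_const_mul, mul_div_assoc]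

end Gibbs

/-! ## §2 The instance for the capped stiffness observable of the crux -/

section CapStiff

variable (F : T3Family)

/-- **`stub_cgfConvexCapped` UNFOLDED** — for the capped stiffness `X_j = β_{K−j}·Σ_{a ∈ Plaq_j} min(|Ū^j(∂a) − 1|², θ(K−j)²)` of the crux
`CappedCoarseStiffnessL` under the Wilson–Gibbs law `gibbsK F ℰp γ K` (`γ ≥ 0`), and every real `c`:
`∫ e^{cX_j} ≤ exp(c·∫ X_j e^{cX_j} / ∫ e^{cX_j})` — `integral_exp_mul_le_exp_mul_tilted_mean` with the bound `|X_j| ≤ β·#Plaq_j·θ²` and the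
measurability of `X_j` (measurable averaging maps, `LargeFieldMassRefinementTailSubGaussianRung.measurable_dist1_iter`). [folklore] -/
theorem cgfConvex_capStiff {γ : ℝ} (hγ : 0 ≤ γ) (b₀ p₀ : ℝ) (K j : ℕ) (c : ℝ) :
    ∫ U, Real.exp (c * ((γ * ((F.L : ℝ)⁻¹) ^ (K - j))⁻¹ *
        ∑ a : Plaq (F.P K) j, min (GaugeGroup.dist1 (GaugeField.plaqHol
          (Averaging.iter (fun i => BlockAveraging.blockAvg (P := F.P K) (j := i) T3UnitLawDensityEML.ℰp) j U) a) ^ 2)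
          (T3UnitScaleTilt.θBal F.L γ b₀ p₀ (K - j) ^ 2))) ∂(T3UnitScaleTilt.gibbsK F T3UnitLawDensityEML.ℰp γ K) ≤
      Real.exp (c * ((∫ U, ((γ * ((F.L : ℝ)⁻¹) ^ (K - j))⁻¹ *
          ∑ a : Plaq (F.P K) j, min (GaugeGroup.dist1 (GaugeField.plaqHol
            (Averaging.iter (fun i => BlockAveraging.blockAvg (P := F.P K) (j := i) T3UnitLawDensityEML.ℰp) j U) a) ^ 2)
            (T3UnitScaleTilt.θBal F.L γ b₀ p₀ (K - j) ^ 2)) *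
          Real.exp (c * ((γ * ((F.L : ℝ)⁻¹) ^ (K - j))⁻¹ *
            ∑ a : Plaq (F.P K) j, min (GaugeGroup.dist1 (GaugeField.plaqHol
              (Averaging.iter (fun i => BlockAveraging.blockAvg (P := F.P K) (j := i) T3UnitLawDensityEML.ℰp) j U) a) ^ 2)
              (T3UnitScaleTilt.θBal F.L γ b₀ p₀ (K - j) ^ 2))) ∂(T3UnitScaleTilt.gibbsK F T3UnitLawDensityEML.ℰp γ K)) /
        (∫ U, Real.exp (c * ((γ * ((F.L : ℝ)⁻¹) ^ (K - j))⁻¹ *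
            ∑ a : Plaq (F.P K) j, min (GaugeGroup.dist1 (GaugeField.plaqHol
              (Averaging.iter (fun i => BlockAveraging.blockAvg (P := F.P K) (j := i) T3UnitLawDensityEML.ℰp) j U) a) ^ 2)
              (T3UnitScaleTilt.θBal F.L γ b₀ p₀ (K - j) ^ 2))) ∂(T3UnitScaleTilt.gibbsK F T3UnitLawDensityEML.ℰp γ K)))) := by
  haveI := T3UnitScaleTilt.isProbabilityMeasure_gibbsK F T3UnitLawDensityEML.ℰp hγ K
  set β : ℝ := (γ * ((F.L : ℝ)⁻¹) ^ (K - j))⁻¹ with hβdef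
  set θ : ℝ := T3UnitScaleTilt.θBal F.L γ b₀ p₀ (K - j) with hθdef
  -- measurability: measurable (0.4)-averaging maps, plaquette variable, `dist1`, finite sums and `min`
  have hmeas : Measurable fun U : GaugeField (F.P K) 0 (Matrix.specialUnitaryGroup (Fin 2) ℂ) =>
      β * ∑ a : Plaq (F.P K) j, min (GaugeGroup.dist1 (GaugeField.plaqHol
        (Averaging.iter (fun i => BlockAveraging.blockAvg (P := F.P K) (j := i) T3UnitLawDensityEML.ℰp) j U) a) ^ 2) (θ ^ 2) := by
    refine (Finset.measurable_sum _ fun a _ => ?_).const_mul β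
    exact ((measurable_dist1_iter F K j a).pow_const 2).min measurable_const
  -- boundedness: `0 ≤ Σ_a min(·, θ²) ≤ #Plaq_j·θ²`
  have hbdd : ∀ U : GaugeField (F.P K) 0 (Matrix.specialUnitaryGroup (Fin 2) ℂ),
      |β * ∑ a : Plaq (F.P K) j, min (GaugeGroup.dist1 (GaugeField.plaqHol
        (Averaging.iter (fun i => BlockAveraging.blockAvg (P := F.P K) (j := i) T3UnitLawDensityEML.ℰp) j U) a) ^ 2) (θ ^ 2)| ≤
        |β| * ((Fintype.card (Plaq (F.P K) j) : ℝ) * θ ^ 2) := fun U => by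
    have h0 : 0 ≤ ∑ a : Plaq (F.P K) j, min (GaugeGroup.dist1 (GaugeField.plaqHol
        (Averaging.iter (fun i => BlockAveraging.blockAvg (P := F.P K) (j := i) T3UnitLawDensityEML.ℰp) j U) a) ^ 2) (θ ^ 2) :=
      Finset.sum_nonneg fun a _ => le_min (sq_nonneg _) (sq_nonneg _)
    have h1 : ∑ a : Plaq (F.P K) j, min (GaugeGroup.dist1 (GaugeField.plaqHol
        (Averaging.iter (fun i => BlockAveraging.blockAvg (P := F.P K) (j := i) T3UnitLawDensityEML.ℰp) j U) a) ^ 2) (θ ^ 2) ≤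
        (Fintype.card (Plaq (F.P K) j) : ℝ) * θ ^ 2 := by
      calc ∑ a : Plaq (F.P K) j, min (GaugeGroup.dist1 (GaugeField.plaqHol
            (Averaging.iter (fun i => BlockAveraging.blockAvg (P := F.P K) (j := i) T3UnitLawDensityEML.ℰp) j U) a) ^ 2) (θ ^ 2)
          ≤ ∑ _a : Plaq (F.P K) j, θ ^ 2 := Finset.sum_le_sum fun a _ => min_le_right _ _
        _ = (Fintype.card (Plaq (F.P K) j) : ℝ) * θ ^ 2 := by rw [Finset.sum_const, Finset.card_univ, nsmul_eq_mul]
    rw [abs_mul, abs_of_nonneg h0]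
    exact mul_le_mul_of_nonneg_left h1 (abs_nonneg β)
  exact integral_exp_mul_le_exp_mul_tilted_mean (T3UnitScaleTilt.gibbsK F T3UnitLawDensityEML.ℰp γ K) hmeas hbdd c

end CapStiff


/-! ## §3 The registered stub BY NAME AND SIGNATURE -/

section Stub

/-- **REGISTERED STUB `stub_cgfConvexCapped`** of the birth skeleton of crux `CappedCoarseStiffnessL` (stmt-QuantumFields-25301; lead's reshape r1,
skeleton sha da4db308…), VERBATIM: for every family, coupling `γ > 0`, cut-off `K`, height `j`, and `c ≥ 0`, the capped tilted partition function is at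
most `exp(c × the tilted mean of the capped stiffness)` — `cgfConvex_capStiff` (the guards `0 < γ`, `0 ≤ c` are idle). [folklore] -/
theorem stub_cgfConvexCapped :
    ∀ (F : T3Family) (γ b₀ p₀ : ℝ), 0 < γ → ∀ (K j : ℕ) (c : ℝ), 0 ≤ c →
      ∫ U, Real.exp (c * ((γ * ((F.L : ℝ)⁻¹) ^ (K - j))⁻¹ *
          ∑ a : Plaq (F.P K) j, min (GaugeGroup.dist1 (GaugeField.plaqHol
            (Averaging.iter (fun i => BlockAveraging.blockAvg (P := F.P K) (j := i) T3UnitLawDensityEML.ℰp) j U) a) ^ 2)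
            (T3UnitScaleTilt.θBal F.L γ b₀ p₀ (K - j) ^ 2))) ∂(T3UnitScaleTilt.gibbsK F T3UnitLawDensityEML.ℰp γ K) ≤
        Real.exp (c * ((∫ U, ((γ * ((F.L : ℝ)⁻¹) ^ (K - j))⁻¹ *
          ∑ a : Plaq (F.P K) j, min (GaugeGroup.dist1 (GaugeField.plaqHol
            (Averaging.iter (fun i => BlockAveraging.blockAvg (P := F.P K) (j := i) T3UnitLawDensityEML.ℰp) j U) a) ^ 2)
            (T3UnitScaleTilt.θBal F.L γ b₀ p₀ (K - j) ^ 2)) *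
            Real.exp (c * ((γ * ((F.L : ℝ)⁻¹) ^ (K - j))⁻¹ *
          ∑ a : Plaq (F.P K) j, min (GaugeGroup.dist1 (GaugeField.plaqHol
            (Averaging.iter (fun i => BlockAveraging.blockAvg (P := F.P K) (j := i) T3UnitLawDensityEML.ℰp) j U) a) ^ 2)
            (T3UnitScaleTilt.θBal F.L γ b₀ p₀ (K - j) ^ 2))) ∂(T3UnitScaleTilt.gibbsK F T3UnitLawDensityEML.ℰp γ K)) /
          (∫ U, Real.exp (c * ((γ * ((F.L : ℝ)⁻¹) ^ (K - j))⁻¹ *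
          ∑ a : Plaq (F.P K) j, min (GaugeGroup.dist1 (GaugeField.plaqHol
            (Averaging.iter (fun i => BlockAveraging.blockAvg (P := F.P K) (j := i) T3UnitLawDensityEML.ℰp) j U) a) ^ 2)
            (T3UnitScaleTilt.θBal F.L γ b₀ p₀ (K - j) ^ 2))) ∂(T3UnitScaleTilt.gibbsK F T3UnitLawDensityEML.ℰp γ K)))) :=
  fun F _γ b₀ p₀ hγ K j c _ => cgfConvex_capStiff F hγ.le b₀ p₀ K j c

end Stub

end Summit.QuantumFields.YangMills.Theorems.CoarseStiffnessTailCappedCoarseStiffnessLCgfConvex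

end
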